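import Summits.BirchSwinnertonDyer.BirchSwinnertonDyer.Theorems.BiquadraticEisensteinDescentManinDatumSupercuspidalCMInertSevenDivisionGaloisCount
import Summits.BirchSwinnertonDyer.BirchSwinnertonDyer.Theorems.BiquadraticEisensteinDescentManinDatumSupercuspidalCMInertTameResolvent
import Mathlib.Algebra.Ring.GeomSum
import HarnessLib

set_option linter.dupNamespace false -- `Summit.BirchSwinnertonDyer.BirchSwinnertonDyer.Theorems.…` (summit = sub, D-0017)
set_option autoImplicit false

/-!
# Crux `ManinDatumSupercuspidalCMInert` (stmt-BirchSwinnertonDyer-20111, BED r605), CM side of H₇ — step (d) of memo PLAIN-ODD-57,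
# fifth brick (a): the ARITHMETIC inputs of the resolvent bound — `2 + i` has exact order `48` modulo `7`, Euler's criterion
# `(u/7)₄ ≡ u¹²`, and `χ(σ_u) = (u/7)₄^{−k} ≡ θ(σ_u)^{48−12k} (mod 𝔪)` for the tame character `θ(σ_u) = t_u/t_1`

Route `BiquadraticEisensteinDescent` (cell `pub/bsd-wall`, width seat `bsd-wall-cm-bed-w4` g11, RESOLVENT/GALOIS LANE; `--supports`
stmt-BirchSwinnertonDyer-20111, helper). THEOREMS ONLY (no definition, no named fact, no `sorry`); BSD is not proved by any of this.

For every valuation `v` of `ℂ` with `v 7 < 1` (`X_c = ℘(c/7)/ϖ₀²`, `Y_c = ℘′(c/7)/(2ϖ₀³)`, `t_c = X_c/Y_c`):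
* `order_two_add_I`, `dvd_fortyEight_of_val_zpow_sub_one_lt`, `dvd_fortyEight_of_val_theta_zpow` — `θ ≡ 2 + i`, `v(θ^m − 1) < 1 ⇒ 48 ∣ m`
  (the hypothesis `hθ` of bed-w4 g10's `…TameResolvent.resolvent_valuation_le` with `e = 48`, for `θ = t_{2+i}/t_1`);
* `seven_dvd_pow_mul_quarticCharMod_pow_sub_one`, ★ `val_inv_pow_sub_theta_pow_lt` — `v(((w/7)₄^k)⁻¹ − (t_w/t_1)^{48−12k}) < 1`
  (the hypothesis `hχθ`: `χ ≡ θ^j`, `j = 48 − 12k`; `…SevenDivisionTameCharacter.val_t_sub_mul_lt` gives `θ ≡ w`);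
* `coe_sum_smul_pow`, `algEquiv_sum_smul_pow` — bookkeeping for the power basis `Σ a_j t_1^j` of `K₇ = ℚ(i)(E₀[7])`.

References: [Serre1979] Ch. IV §2 Prop. 7; [IrelandRosen1982] Ch. 9 §7–§8; [CasselsFrohlich1967] Ch. I §5–§6.
-/

noncomputable section

open scoped ComplexConjugate
open Complex PeriodPair Polynomial
open scoped PeriodPair IntermediateField BigOperators
open Literature.NumberTheory.EllipticCurves Literature.NumberTheory.EllipticCurves.GaussianLattice
open Literature.NumberTheory.LFunctions.GaussianTheta
open Literature.NumberTheory.QuadraticFields.GaussianQuarticSymbol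

namespace Summit.BirchSwinnertonDyer.BirchSwinnertonDyer.Theorems.BiquadraticEisensteinDescentManinDatumSupercuspidalCMInertSevenDivisionResolventArithmetic

open Summit.BirchSwinnertonDyer.BirchSwinnertonDyer.Theorems.BiquadraticEisensteinDescentManinDatumSupercuspidalCMInertTameResolvent
open Summit.BirchSwinnertonDyer.BirchSwinnertonDyer.Theorems.BiquadraticEisensteinDescentManinDatumSupercuspidalCMInertSevenDivisionPoints
open Summit.BirchSwinnertonDyer.BirchSwinnertonDyer.Theorems.BiquadraticEisensteinDescentManinDatumSupercuspidalCMInertSevenDivisionTameCharacter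
  (val_t_sub_mul_lt)
open Summit.BirchSwinnertonDyer.BirchSwinnertonDyer.Theorems.BiquadraticEisensteinDescentManinDatumSupercuspidalCMInertSevenDivisionField
open Summit.BirchSwinnertonDyer.BirchSwinnertonDyer.Theorems.BiquadraticEisensteinDescentManinDatumSupercuspidalCMInertSevenDivisionGalois
open Summit.BirchSwinnertonDyer.BirchSwinnertonDyer.Theorems.BiquadraticEisensteinDescentManinDatumSupercuspidalCMInertSevenDivisionGaloisCount
open Summit.BirchSwinnertonDyer.BirchSwinnertonDyer.Theorems.BiquadraticEisensteinDescentManinDatumSupercuspidalCMInertValuedPowerSums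
open Summit.BirchSwinnertonDyer.BirchSwinnertonDyer.Theorems.BiquadraticEisensteinDescentManinDatumSupercuspidalCMInertTorsionSumRational
  (cls_eq_cls_iff)

/-! ## §8 The two arithmetic inputs: exact order `48`, and Euler's criterion -/

section Arithmetic

variable {Γ₀ : Type*} [LinearOrderedCommGroupWithZero Γ₀] (v : Valuation ℂ Γ₀)

/-- **`2 + i` has order `48` modulo `7`**: `7 ∣ (2+i)⁴⁸ − 1`, `7 ∤ (2+i)²⁴ − 1`, `7 ∤ (2+i)¹⁶ − 1` in `ℤ[i]`. [cite: IrelandRosen1982, Ch. 9 §7 Lemma 4 (`ℤ[i]/7 = 𝔽₄₉`)] -/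
theorem order_two_add_I :
    (7 : GaussianInt) ∣ (⟨2, 1⟩ : GaussianInt) ^ 48 - 1 ∧ ¬ (7 : GaussianInt) ∣ (⟨2, 1⟩ : GaussianInt) ^ 24 - 1 ∧
      ¬ (7 : GaussianInt) ∣ (⟨2, 1⟩ : GaussianInt) ^ 16 - 1 := by
  refine ⟨(seven_dvd_iff _).mpr (by decide +kernel), fun h ↦ ?_, fun h ↦ ?_⟩
  · exact absurd ((seven_dvd_iff _).mp h) (by decide +kernel)
  · exact absurd ((seven_dvd_iff _).mp h) (by decide +kernel)

/-- `v(z) < 1` for `z ∈ 7ℤ[i]`, and `v(z) = 1` otherwise, read on `((z : ℤ[i]) : ℂ)`. [folklore] -/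
theorem val_toComplex_lt_one_iff (h7 : v 7 < 1) (z : GaussianInt) : v ((z : GaussianInt) : ℂ) < 1 ↔ (7 : GaussianInt) ∣ z := by
  constructor
  · intro h
    by_contra hz
    exact absurd (val_toComplex_eq_one v h7 hz) (ne_of_lt h)
  · rintro ⟨w, rfl⟩
    rw [map_mul, map_ofNat, Valuation.map_mul]
    exact mul_lt_one_of_lt_of_le h7 (val_toComplex_le_one v w)

/-- ★ **Exact order `48` of the tame character.** If `θ ∈ ℂ` satisfies `v(θ − (2+i)) < 1` and `v(θ^m − 1) < 1` for an integer `m`, then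
`48 ∣ m` (`θ^m ≡ (2+i)^m`; with `d = gcd(m, 48)`, `(2+i)^d ≡ 1`, and `d ∣ 24` or `d ∣ 16` unless `d = 48`). [cite: Serre1979, Ch. IV §2 Prop. 7] -/
theorem dvd_fortyEight_of_val_zpow_sub_one_lt (h7 : v 7 < 1) {θ : ℂ} (hθ : v (θ - (((⟨2, 1⟩ : GaussianInt)) : ℂ)) < 1)
    {m : ℤ} (hm : v (θ ^ m - 1) < 1) : (48 : ℤ) ∣ m := by
  set g : ℂ := (((⟨2, 1⟩ : GaussianInt)) : ℂ) with hg
  have hg7 : ¬ (7 : GaussianInt) ∣ (⟨2, 1⟩ : GaussianInt) := fun h ↦ by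
    have := (seven_dvd_iff _).mp h; norm_num at this
  have hvg : v g = 1 := val_toComplex_eq_one v h7 hg7
  have hg0 : g ≠ 0 := fun h ↦ by rw [h, Valuation.map_zero] at hvg; exact zero_ne_one hvg
  -- `θ ≡ g`: `θ/g ≡ 1`, so `g^m ≡ θ^m ≡ 1`
  have h1 : v (θ / g - 1) < 1 := near_one_div_of_sub_lt v hθ hvg
  have hθ0 : θ ≠ 0 := by
    intro h
    rw [h, zero_div, zero_sub, Valuation.map_neg, Valuation.map_one] at h1
    exact lt_irrefl _ h1
  have hgm : v (g ^ m - 1) < 1 := by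
    have h2 := near_one_mul v hm (near_one_inv v (near_one_zpow v h1 m))
    have heq : (θ ^ m) * ((θ / g) ^ m)⁻¹ = g ^ m := by
      rw [div_zpow, inv_div, mul_div_assoc', mul_div_cancel_left₀ _ (zpow_ne_zero m hθ0)]
    rwa [heq] at h2
  -- powers of `g` in `ℤ[i]`
  obtain ⟨h48, h24, h16⟩ := order_two_add_I
  have hcast : ∀ n : ℕ, g ^ n - 1 = (((⟨2, 1⟩ : GaussianInt) ^ n - 1 : GaussianInt) : ℂ) := fun n ↦ by
    rw [map_sub, map_pow, map_one]
  have hg48 : v (g ^ (48 : ℤ) - 1) < 1 := by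
    rw [zpow_ofNat, hcast]; exact (val_toComplex_lt_one_iff v h7 _).mpr h48
  -- `d = gcd(m, 48)`: `g^d ≡ 1`
  set d : ℕ := Int.gcd m 48 with hd
  have hgd : v (g ^ (d : ℤ) - 1) < 1 := by
    have hbez : (d : ℤ) = m * Int.gcdA m 48 + 48 * Int.gcdB m 48 := Int.gcd_eq_gcd_ab m 48
    have heq : g ^ (d : ℤ) = (g ^ m) ^ Int.gcdA m 48 * (g ^ (48 : ℤ)) ^ Int.gcdB m 48 := by
      rw [hbez, zpow_add₀ hg0, zpow_mul, zpow_mul]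
    rw [heq]
    exact near_one_mul v (near_one_zpow v hgm _) (near_one_zpow v hg48 _)
  have hd48 : d ∣ 48 := Int.gcd_dvd_natAbs_right m 48
  have hdm : (d : ℤ) ∣ m := Int.gcd_dvd_left m 48
  -- every proper divisor of `48` divides `24` or `16`
  have hcases : d = 48 ∨ d ∣ 24 ∨ d ∣ 16 := by
    have hmem : d ∈ Nat.divisors 48 := Nat.mem_divisors.mpr ⟨hd48, by norm_num⟩
    have key : ∀ d' ∈ Nat.divisors 48, d' = 48 ∨ d' ∣ 24 ∨ d' ∣ 16 := by decide
    exact key d hmem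
  rcases hcases with h | h | h
  · have h' : (d : ℤ) = 48 := by exact_mod_cast h
    rw [← h']; exact hdm
  · exfalso
    obtain ⟨e, he⟩ := h
    have : v (g ^ (24 : ℤ) - 1) < 1 := by
      rw [show (24 : ℤ) = (d : ℤ) * e by exact_mod_cast he, zpow_mul]
      exact near_one_zpow v hgd _
    rw [zpow_ofNat, hcast] at this
    exact h24 ((val_toComplex_lt_one_iff v h7 _).mp this)
  · exfalso
    obtain ⟨e, he⟩ := h
    have : v (g ^ (16 : ℤ) - 1) < 1 := by
      rw [show (16 : ℤ) = (d : ℤ) * e by exact_mod_cast he, zpow_mul]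
      exact near_one_zpow v hgd _
    rw [zpow_ofNat, hcast] at this
    exact h16 ((val_toComplex_lt_one_iff v h7 _).mp this)

/-- ★ **Euler's criterion, resolvent form**: for `7 ∤ u` and `k ≤ 4`, `7 ∣ u^{48−12k} · (u/7)₄^k − 1` in `ℤ[i]`
(`(u/7)₄ ≡ u¹²`, `(u/7)₄⁴ = 1`). [cite: IrelandRosen1982, Ch. 9 §8, Prop. 9.8.2 and Definition] -/
theorem seven_dvd_pow_mul_quarticCharMod_pow_sub_one {u : GaussianInt} (hu : ¬ (7 : GaussianInt) ∣ u) {k : ℕ} (hk : k ≤ 4) :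
    (7 : GaussianInt) ∣ u ^ (48 - 12 * k) * quarticCharMod 7 u ^ k - 1 := by
  obtain ⟨heuler, h4⟩ := quarticCharMod_natCast_spec (q := 7) (by norm_num) (by norm_num) (x := u) (by exact_mod_cast hu)
  rw [show ((7 ^ 2 - 1) / 4 : ℕ) = 12 from rfl] at heuler
  have heuler' : (7 : GaussianInt) ∣ u ^ 12 - quarticCharMod 7 u := by exact_mod_cast heuler
  -- `u^{12k} ≡ q^k` and `u⁴⁸ ≡ q⁴ = 1`
  have hk' : (7 : GaussianInt) ∣ (u ^ 12) ^ k - quarticCharMod 7 u ^ k := heuler'.trans (sub_dvd_pow_sub_pow _ _ k)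
  have h48 : (7 : GaussianInt) ∣ (u ^ 12) ^ 4 - quarticCharMod 7 u ^ 4 := heuler'.trans (sub_dvd_pow_sub_pow _ _ 4)
  have h4' : quarticCharMod 7 u ^ 4 = 1 := by exact_mod_cast h4
  rw [h4'] at h48
  have heq : u ^ (48 - 12 * k) * quarticCharMod 7 u ^ k - 1 =
      -(u ^ (48 - 12 * k) * ((u ^ 12) ^ k - quarticCharMod 7 u ^ k)) + ((u ^ 12) ^ 4 - 1) := by
    have : (u ^ 12) ^ 4 = u ^ (48 - 12 * k) * (u ^ 12) ^ k := by
      rw [← pow_mul, ← pow_mul, ← pow_add]; congr 1; omega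
    rw [this]; ring
  rw [heq]
  exact dvd_add (dvd_neg.mpr (Dvd.dvd.mul_left hk' _)) h48

end Arithmetic

/-! ## §9 The resolvent bound -/

section PureComplex

variable {Γ₀ : Type*} [LinearOrderedCommGroupWithZero Γ₀] (v : Valuation ℂ Γ₀)

/-- `v((w/7)₄) = 1` and `(w/7)₄ ≠ 0` in `ℂ` for `7 ∤ w` (a fourth root of unity). [cite: IrelandRosen1982, Ch. 9 §8 Prop. 9.8.2] -/
theorem val_quarticCharMod_eq_one (h7 : v 7 < 1) {w : GaussianInt} (hw : ¬ (7 : GaussianInt) ∣ w) :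
    v ((quarticCharMod 7 w : GaussianInt) : ℂ) = 1 ∧ ((quarticCharMod 7 w : GaussianInt) : ℂ) ≠ 0 := by
  have h4 : quarticCharMod 7 w ^ 4 = 1 := by
    have h := (quarticCharMod_natCast_spec (q := 7) (by norm_num) (by norm_num) (x := w) (by exact_mod_cast hw)).2
    exact_mod_cast h
  have hv : v ((quarticCharMod 7 w : GaussianInt) : ℂ) = 1 := by
    apply pow_left_injective (by norm_num : (4 : ℕ) ≠ 0)
    dsimp only
    rw [← Valuation.map_pow, ← map_pow, h4, map_one, Valuation.map_one, one_pow]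
  have _h7 := h7
  exact ⟨hv, fun h ↦ by rw [h, Valuation.map_zero] at hv; exact zero_ne_one hv⟩

/-- ★ **`χ(σ_w) ≡ θ(σ_w)^{48−12k} (mod 𝔪)`** in `ℂ`: for `7 ∤ w`, `k ≤ 4` and `θ_w = (t_w/t_1)`,
`v(((w/7)₄^k)⁻¹ − θ_w^{48−12k}) < 1` (`θ_w ≡ w` by `val_t_sub_mul_lt`, and `w^{48−12k}(w/7)₄^k ≡ 1` by Euler's criterion).
[cite: Serre1979, Ch. IV §2 Prop. 7] [cite: IrelandRosen1982, Ch. 9 §8 Prop. 9.8.2] -/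
theorem val_inv_pow_sub_theta_pow_lt (h7 : v 7 < 1) {w : GaussianInt} (hw : ¬ (7 : GaussianInt) ∣ w) {k : ℕ} (hk : k ≤ 4) :
    v (((((quarticCharMod 7 w : GaussianInt) : ℂ)) ^ k)⁻¹ -
      ((℘[ofUpperHalfPlane UpperHalfPlane.I] (((w : GaussianInt) : ℂ) / 7) / ((Real.Gamma (1 / 4) ^ 2 / (2 * Real.sqrt (2 * Real.pi)) : ℝ) : ℂ) ^ 2) /
          (℘'[ofUpperHalfPlane UpperHalfPlane.I] (((w : GaussianInt) : ℂ) / 7) / (2 * ((Real.Gamma (1 / 4) ^ 2 / (2 * Real.sqrt (2 * Real.pi)) : ℝ) : ℂ) ^ 3)) /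
          ((℘[ofUpperHalfPlane UpperHalfPlane.I] (((1 : GaussianInt) : ℂ) / 7) / ((Real.Gamma (1 / 4) ^ 2 / (2 * Real.sqrt (2 * Real.pi)) : ℝ) : ℂ) ^ 2) /
          (℘'[ofUpperHalfPlane UpperHalfPlane.I] (((1 : GaussianInt) : ℂ) / 7) / (2 * ((Real.Gamma (1 / 4) ^ 2 / (2 * Real.sqrt (2 * Real.pi)) : ℝ) : ℂ) ^ 3)))) ^ (48 - 12 * k)) < 1 := by
  have h1 : ¬ (7 : GaussianInt) ∣ 1 := not_seven_dvd_one
  obtain ⟨hX0, hY0, -, -⟩ := val_division v h7 h1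
  obtain ⟨hr0, -⟩ := val_t_lt_one v h7 h1
  obtain ⟨hvq, hq0⟩ := val_quarticCharMod_eq_one v h7 hw
  set θ : ℂ := (℘[ofUpperHalfPlane UpperHalfPlane.I] (((w : GaussianInt) : ℂ) / 7) / ((Real.Gamma (1 / 4) ^ 2 / (2 * Real.sqrt (2 * Real.pi)) : ℝ) : ℂ) ^ 2) /
      (℘'[ofUpperHalfPlane UpperHalfPlane.I] (((w : GaussianInt) : ℂ) / 7) / (2 * ((Real.Gamma (1 / 4) ^ 2 / (2 * Real.sqrt (2 * Real.pi)) : ℝ) : ℂ) ^ 3)) /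
      ((℘[ofUpperHalfPlane UpperHalfPlane.I] (((1 : GaussianInt) : ℂ) / 7) / ((Real.Gamma (1 / 4) ^ 2 / (2 * Real.sqrt (2 * Real.pi)) : ℝ) : ℂ) ^ 2) /
      (℘'[ofUpperHalfPlane UpperHalfPlane.I] (((1 : GaussianInt) : ℂ) / 7) / (2 * ((Real.Gamma (1 / 4) ^ 2 / (2 * Real.sqrt (2 * Real.pi)) : ℝ) : ℂ) ^ 3))) with hθdef
  set q : ℂ := ((quarticCharMod 7 w : GaussianInt) : ℂ) with hqdef
  set z : ℂ := ((w : GaussianInt) : ℂ) with hzdef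
  have hvz : v z = 1 := val_toComplex_eq_one v h7 hw
  have hz0 : z ≠ 0 := fun h ↦ by rw [h, Valuation.map_zero] at hvz; exact zero_ne_one hvz
  -- `θ ≡ z`
  have hθz : v (θ - z) < 1 := by
    have hlt := val_t_sub_mul_lt v h7 w hw
    have ht0 : (℘[ofUpperHalfPlane UpperHalfPlane.I] (((1 : GaussianInt) : ℂ) / 7) / ((Real.Gamma (1 / 4) ^ 2 / (2 * Real.sqrt (2 * Real.pi)) : ℝ) : ℂ) ^ 2) /
        (℘'[ofUpperHalfPlane UpperHalfPlane.I] (((1 : GaussianInt) : ℂ) / 7) / (2 * ((Real.Gamma (1 / 4) ^ 2 / (2 * Real.sqrt (2 * Real.pi)) : ℝ) : ℂ) ^ 3)) ≠ 0 := div_ne_zero hX0 hY0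
    have : θ - z = ((℘[ofUpperHalfPlane UpperHalfPlane.I] (((w : GaussianInt) : ℂ) / 7) / ((Real.Gamma (1 / 4) ^ 2 / (2 * Real.sqrt (2 * Real.pi)) : ℝ) : ℂ) ^ 2) /
        (℘'[ofUpperHalfPlane UpperHalfPlane.I] (((w : GaussianInt) : ℂ) / 7) / (2 * ((Real.Gamma (1 / 4) ^ 2 / (2 * Real.sqrt (2 * Real.pi)) : ℝ) : ℂ) ^ 3)) - z *
        ((℘[ofUpperHalfPlane UpperHalfPlane.I] (((1 : GaussianInt) : ℂ) / 7) / ((Real.Gamma (1 / 4) ^ 2 / (2 * Real.sqrt (2 * Real.pi)) : ℝ) : ℂ) ^ 2) /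
        (℘'[ofUpperHalfPlane UpperHalfPlane.I] (((1 : GaussianInt) : ℂ) / 7) / (2 * ((Real.Gamma (1 / 4) ^ 2 / (2 * Real.sqrt (2 * Real.pi)) : ℝ) : ℂ) ^ 3)))) /
        ((℘[ofUpperHalfPlane UpperHalfPlane.I] (((1 : GaussianInt) : ℂ) / 7) / ((Real.Gamma (1 / 4) ^ 2 / (2 * Real.sqrt (2 * Real.pi)) : ℝ) : ℂ) ^ 2) /
        (℘'[ofUpperHalfPlane UpperHalfPlane.I] (((1 : GaussianInt) : ℂ) / 7) / (2 * ((Real.Gamma (1 / 4) ^ 2 / (2 * Real.sqrt (2 * Real.pi)) : ℝ) : ℂ) ^ 3))) := by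
      rw [hθdef, sub_div, mul_div_cancel_right₀ _ ht0]
    rw [this, map_div₀, div_lt_one₀ hr0]
    exact hlt
  -- `θ^j ≡ z^j`
  have hθj : v (θ ^ (48 - 12 * k) - z ^ (48 - 12 * k)) < 1 := by
    have h1' : v (θ / z - 1) < 1 := near_one_div_of_sub_lt v hθz hvz
    have h2 := near_one_zpow v h1' ((48 - 12 * k : ℕ) : ℤ)
    rw [zpow_natCast] at h2
    have hid : ∀ (a b : ℂ) (j : ℕ), b ≠ 0 → a ^ j - b ^ j = b ^ j * ((a / b) ^ j - 1) := fun a b j hb ↦ by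
      rw [div_pow, mul_sub, mul_one, mul_div_assoc', mul_div_cancel_left₀ _ (pow_ne_zero _ hb)]
    have := hid θ z (48 - 12 * k) hz0
    rw [this, Valuation.map_mul, Valuation.map_pow, hvz, one_pow, one_mul]
    exact h2
  -- Euler: `z^j q^k ≡ 1`
  have heuler : v (z ^ (48 - 12 * k) * q ^ k - 1) < 1 := by
    have h := seven_dvd_pow_mul_quarticCharMod_pow_sub_one hw (k := k) hk
    have : z ^ (48 - 12 * k) * q ^ k - 1 = (((w ^ (48 - 12 * k) * quarticCharMod 7 w ^ k - 1 : GaussianInt)) : ℂ) := by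
      rw [map_sub, map_mul, map_pow, map_pow, map_one]
    rw [this]
    exact (val_toComplex_lt_one_iff v h7 _).mpr h
  have hθq : v (θ ^ (48 - 12 * k) * q ^ k - 1) < 1 := by
    have : θ ^ (48 - 12 * k) * q ^ k - 1 = q ^ k * (θ ^ (48 - 12 * k) - z ^ (48 - 12 * k)) + (z ^ (48 - 12 * k) * q ^ k - 1) := by
      ring
    rw [this]
    refine Valuation.map_add_lt v ?_ heuler
    rw [Valuation.map_mul, Valuation.map_pow, hvq, one_pow, one_mul]
    exact hθj
  have hqk0 : q ^ k ≠ 0 := pow_ne_zero _ hq0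
  have hid2 : (q ^ k)⁻¹ * (θ ^ (48 - 12 * k) * q ^ k - 1) = θ ^ (48 - 12 * k) - (q ^ k)⁻¹ := by
    rw [mul_sub, mul_one, mul_comm (θ ^ (48 - 12 * k)) (q ^ k), ← mul_assoc, inv_mul_cancel₀ hqk0, one_mul]
  have : (q ^ k)⁻¹ - θ ^ (48 - 12 * k) = -((q ^ k)⁻¹ * (θ ^ (48 - 12 * k) * q ^ k - 1)) := by
    rw [hid2]; ring
  rw [this, Valuation.map_neg, Valuation.map_mul, map_inv₀, Valuation.map_pow, hvq, one_pow, inv_one, one_mul]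
  exact hθq

/-- **Exact order `48`, geometric form**: for `θ = t_{2+i}/t_1`, `v(θ^m − 1) < 1 ⇒ 48 ∣ m`. [cite: Serre1979, Ch. IV §2 Prop. 7] -/
theorem dvd_fortyEight_of_val_theta_zpow (h7 : v 7 < 1) {m : ℤ}
    (hm : v (((℘[ofUpperHalfPlane UpperHalfPlane.I] ((((⟨2, 1⟩ : GaussianInt) : GaussianInt) : ℂ) / 7) / ((Real.Gamma (1 / 4) ^ 2 / (2 * Real.sqrt (2 * Real.pi)) : ℝ) : ℂ) ^ 2) /
        (℘'[ofUpperHalfPlane UpperHalfPlane.I] ((((⟨2, 1⟩ : GaussianInt) : GaussianInt) : ℂ) / 7) / (2 * ((Real.Gamma (1 / 4) ^ 2 / (2 * Real.sqrt (2 * Real.pi)) : ℝ) : ℂ) ^ 3)) /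
        ((℘[ofUpperHalfPlane UpperHalfPlane.I] (((1 : GaussianInt) : ℂ) / 7) / ((Real.Gamma (1 / 4) ^ 2 / (2 * Real.sqrt (2 * Real.pi)) : ℝ) : ℂ) ^ 2) /
        (℘'[ofUpperHalfPlane UpperHalfPlane.I] (((1 : GaussianInt) : ℂ) / 7) / (2 * ((Real.Gamma (1 / 4) ^ 2 / (2 * Real.sqrt (2 * Real.pi)) : ℝ) : ℂ) ^ 3)))) ^ m - 1) < 1) :
    (48 : ℤ) ∣ m := by
  have h1 : ¬ (7 : GaussianInt) ∣ 1 := not_seven_dvd_one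
  have hg7 : ¬ (7 : GaussianInt) ∣ (⟨2, 1⟩ : GaussianInt) := fun h ↦ by
    have := (seven_dvd_iff _).mp h; norm_num at this
  obtain ⟨hX0, hY0, -, -⟩ := val_division v h7 h1
  obtain ⟨hr0, -⟩ := val_t_lt_one v h7 h1
  refine dvd_fortyEight_of_val_zpow_sub_one_lt v h7 ?_ hm
  have hlt := val_t_sub_mul_lt v h7 (⟨2, 1⟩ : GaussianInt) hg7
  have ht0 : (℘[ofUpperHalfPlane UpperHalfPlane.I] (((1 : GaussianInt) : ℂ) / 7) / ((Real.Gamma (1 / 4) ^ 2 / (2 * Real.sqrt (2 * Real.pi)) : ℝ) : ℂ) ^ 2) /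
      (℘'[ofUpperHalfPlane UpperHalfPlane.I] (((1 : GaussianInt) : ℂ) / 7) / (2 * ((Real.Gamma (1 / 4) ^ 2 / (2 * Real.sqrt (2 * Real.pi)) : ℝ) : ℂ) ^ 3)) ≠ 0 := div_ne_zero hX0 hY0
  have : (℘[ofUpperHalfPlane UpperHalfPlane.I] ((((⟨2, 1⟩ : GaussianInt) : GaussianInt) : ℂ) / 7) / ((Real.Gamma (1 / 4) ^ 2 / (2 * Real.sqrt (2 * Real.pi)) : ℝ) : ℂ) ^ 2) /
      (℘'[ofUpperHalfPlane UpperHalfPlane.I] ((((⟨2, 1⟩ : GaussianInt) : GaussianInt) : ℂ) / 7) / (2 * ((Real.Gamma (1 / 4) ^ 2 / (2 * Real.sqrt (2 * Real.pi)) : ℝ) : ℂ) ^ 3)) /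
      ((℘[ofUpperHalfPlane UpperHalfPlane.I] (((1 : GaussianInt) : ℂ) / 7) / ((Real.Gamma (1 / 4) ^ 2 / (2 * Real.sqrt (2 * Real.pi)) : ℝ) : ℂ) ^ 2) /
      (℘'[ofUpperHalfPlane UpperHalfPlane.I] (((1 : GaussianInt) : ℂ) / 7) / (2 * ((Real.Gamma (1 / 4) ^ 2 / (2 * Real.sqrt (2 * Real.pi)) : ℝ) : ℂ) ^ 3))) - (((⟨2, 1⟩ : GaussianInt)) : ℂ) =
      ((℘[ofUpperHalfPlane UpperHalfPlane.I] ((((⟨2, 1⟩ : GaussianInt) : GaussianInt) : ℂ) / 7) / ((Real.Gamma (1 / 4) ^ 2 / (2 * Real.sqrt (2 * Real.pi)) : ℝ) : ℂ) ^ 2) /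
          (℘'[ofUpperHalfPlane UpperHalfPlane.I] ((((⟨2, 1⟩ : GaussianInt) : GaussianInt) : ℂ) / 7) / (2 * ((Real.Gamma (1 / 4) ^ 2 / (2 * Real.sqrt (2 * Real.pi)) : ℝ) : ℂ) ^ 3)) -
          (((⟨2, 1⟩ : GaussianInt)) : ℂ) *
          ((℘[ofUpperHalfPlane UpperHalfPlane.I] (((1 : GaussianInt) : ℂ) / 7) / ((Real.Gamma (1 / 4) ^ 2 / (2 * Real.sqrt (2 * Real.pi)) : ℝ) : ℂ) ^ 2) /
          (℘'[ofUpperHalfPlane UpperHalfPlane.I] (((1 : GaussianInt) : ℂ) / 7) / (2 * ((Real.Gamma (1 / 4) ^ 2 / (2 * Real.sqrt (2 * Real.pi)) : ℝ) : ℂ) ^ 3)))) /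
          ((℘[ofUpperHalfPlane UpperHalfPlane.I] (((1 : GaussianInt) : ℂ) / 7) / ((Real.Gamma (1 / 4) ^ 2 / (2 * Real.sqrt (2 * Real.pi)) : ℝ) : ℂ) ^ 2) /
          (℘'[ofUpperHalfPlane UpperHalfPlane.I] (((1 : GaussianInt) : ℂ) / 7) / (2 * ((Real.Gamma (1 / 4) ^ 2 / (2 * Real.sqrt (2 * Real.pi)) : ℝ) : ℂ) ^ 3))) := by
    rw [sub_div, mul_div_cancel_right₀ _ ht0]
  rw [this, map_div₀, div_lt_one₀ hr0]
  exact hlt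

end PureComplex

section Field

/-- A power-basis combination, read in `ℂ`: `↑(Σ a_j • s^j) = Σ a_j · (↑s)^j`. [folklore] -/
theorem coe_sum_smul_pow (a : Fin 48 → ℚ⟮I⟯) (s : (IntermediateField.adjoin ℚ⟮I⟯ {x : ℂ | ∃ c : GaussianInt, ¬ (7 : GaussianInt) ∣ c ∧
        (x = ℘[ofUpperHalfPlane UpperHalfPlane.I] (((c : GaussianInt) : ℂ) / 7) / ((Real.Gamma (1 / 4) ^ 2 / (2 * Real.sqrt (2 * Real.pi)) : ℝ) : ℂ) ^ 2 ∨
         x = ℘'[ofUpperHalfPlane UpperHalfPlane.I] (((c : GaussianInt) : ℂ) / 7) / (2 * ((Real.Gamma (1 / 4) ^ 2 / (2 * Real.sqrt (2 * Real.pi)) : ℝ) : ℂ) ^ 3))})) :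
    (((∑ j : Fin 48, a j • s ^ (j : ℕ)) : (IntermediateField.adjoin ℚ⟮I⟯ {x : ℂ | ∃ c : GaussianInt, ¬ (7 : GaussianInt) ∣ c ∧
        (x = ℘[ofUpperHalfPlane UpperHalfPlane.I] (((c : GaussianInt) : ℂ) / 7) / ((Real.Gamma (1 / 4) ^ 2 / (2 * Real.sqrt (2 * Real.pi)) : ℝ) : ℂ) ^ 2 ∨
         x = ℘'[ofUpperHalfPlane UpperHalfPlane.I] (((c : GaussianInt) : ℂ) / 7) / (2 * ((Real.Gamma (1 / 4) ^ 2 / (2 * Real.sqrt (2 * Real.pi)) : ℝ) : ℂ) ^ 3))})) : ℂ) = ∑ j : Fin 48,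
             (((a j : ℚ⟮I⟯) : ℂ)) * (s : ℂ) ^ (j : ℕ) := by
  rw [IntermediateField.coe_sum]
  refine Finset.sum_congr rfl fun j _ ↦ ?_
  rw [IntermediateField.coe_smul, Algebra.smul_def, IntermediateField.coe_pow]
  rfl

/-- Automorphisms on a power-basis combination: `σ(Σ a_j • s^j) = Σ a_j • (σ s)^j`. [folklore] -/
theorem algEquiv_sum_smul_pow (σ : (IntermediateField.adjoin ℚ⟮I⟯ {x : ℂ | ∃ c : GaussianInt, ¬ (7 : GaussianInt) ∣ c ∧
        (x = ℘[ofUpperHalfPlane UpperHalfPlane.I] (((c : GaussianInt) : ℂ) / 7) / ((Real.Gamma (1 / 4) ^ 2 / (2 * Real.sqrt (2 * Real.pi)) : ℝ) : ℂ) ^ 2 ∨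
         x = ℘'[ofUpperHalfPlane UpperHalfPlane.I] (((c : GaussianInt) : ℂ) / 7) / (2 * ((Real.Gamma (1 / 4) ^ 2 / (2 * Real.sqrt (2 * Real.pi)) : ℝ) : ℂ) ^ 3))}) ≃ₐ[ℚ⟮I⟯]
             (IntermediateField.adjoin ℚ⟮I⟯ {x : ℂ | ∃ c : GaussianInt, ¬ (7 : GaussianInt) ∣ c ∧
        (x = ℘[ofUpperHalfPlane UpperHalfPlane.I] (((c : GaussianInt) : ℂ) / 7) / ((Real.Gamma (1 / 4) ^ 2 / (2 * Real.sqrt (2 * Real.pi)) : ℝ) : ℂ) ^ 2 ∨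
         x = ℘'[ofUpperHalfPlane UpperHalfPlane.I] (((c : GaussianInt) : ℂ) / 7) / (2 * ((Real.Gamma (1 / 4) ^ 2 / (2 * Real.sqrt (2 * Real.pi)) : ℝ) : ℂ) ^ 3))})) (a : Fin 48 → ℚ⟮I⟯)
             (s : (IntermediateField.adjoin ℚ⟮I⟯ {x : ℂ | ∃ c : GaussianInt, ¬ (7 : GaussianInt) ∣ c ∧
        (x = ℘[ofUpperHalfPlane UpperHalfPlane.I] (((c : GaussianInt) : ℂ) / 7) / ((Real.Gamma (1 / 4) ^ 2 / (2 * Real.sqrt (2 * Real.pi)) : ℝ) : ℂ) ^ 2 ∨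
         x = ℘'[ofUpperHalfPlane UpperHalfPlane.I] (((c : GaussianInt) : ℂ) / 7) / (2 * ((Real.Gamma (1 / 4) ^ 2 / (2 * Real.sqrt (2 * Real.pi)) : ℝ) : ℂ) ^ 3))})) :
    σ (∑ j : Fin 48, a j • s ^ (j : ℕ)) = ∑ j : Fin 48, a j • (σ s) ^ (j : ℕ) := by
  rw [map_sum]
  refine Finset.sum_congr rfl fun j _ ↦ ?_
  rw [Algebra.smul_def, Algebra.smul_def, map_mul, AlgEquiv.commutes, map_pow]

end Field

end Summit.BirchSwinnertonDyer.BirchSwinnertonDyer.Theorems.BiquadraticEisensteinDescentManinDatumSupercuspidalCMInertSevenDivisionResolventArithmetic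

end
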